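import Literature.MathematicalPhysics.QuantumFieldTheory.ConformalBootstrap3D.BlockSatisfiabilityIff
import Literature.MathematicalPhysics.QuantumFieldTheory.ConformalBootstrap3D.FreeScalarBlockDecomposition
import Literature.MathematicalPhysics.QuantumFieldTheory.ConformalBootstrap3D.BlockDiagonalEnclosure
import Literature.MathematicalPhysics.QuantumFieldTheory.ConformalBootstrap3D.SingleCorrelatorNonVacuity
import Mathlib.Tactic
import HarnessLib

/-!
# Uniqueness of the typed 3D block at EVERY admissible point: the limit clause pins `hrBlock`

Completion of pub-ising3d T1 ("identification") at the non-regular points. The typed predicate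
`IsConformalBlock3D Δ₁₂ Δ₃₄ Δ ℓ g` of `SigmaEpsilonSystem` has two clauses: at a regular point the generic
clause (absolutely convergent `z`-double series + Dolan–Osborn boundary row + Casimir equation), whose
solution on the open square is unique (`BlockCoefficientUniqueness`/`BlockCoefficientExtraction`,
`IsConformalBlock3DAbove.eqOn_of_isRegular`) and is the Hogervorst–Rychkov / Dolan–Osborn series `hrBlock`
(`BlockExistence`) resp. `hrBlockAB` (`BlockExistenceAB`); at a NON-regular point — the unitarity bound
`Δ = ℓ+1`, `ℓ ≥ 1` (conserved currents, the stress tensor `(3,2)`) and the finitely many accidental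
degeneracies per spin — it is the LIMIT clause: `g` is the pointwise limit on the square of generic blocks
`G Δ'`, `Δ' ↓ Δ` (Kos–Poland–Simmons-Duffin 2014 §4: blocks at special `Δ` by continuation in `Δ`).
Existence under the limit clause is `BlockExistenceLimit`/`BlockExistenceLimitAB`. What was NOT in the
tree (paper, Remark "formalised form of Theorem (unique)", last sentence: "Not in Lean: … any statement at
`Δ = ℓ+1` or on the exceptional set") is UNIQUENESS under the limit clause. This file proves it:

* `IsConformalBlock3D.eq_hrBlock_of_isAdmissible` — for equal external dimensions, at EVERY admissible
  point (`IsAdmissible3D`: `Δ ≥ ℓ+1` for `ℓ ≥ 1`, `Δ > 1/2` for `ℓ = 0`) every function with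
  `IsConformalBlock3D 0 0 Δ ℓ g` equals `hrBlock Δ ℓ` on the open square; `IsAdmissible3D.isConformalBlock3D_iff`
  (the predicate holds iff `g` agrees with `hrBlock` on the square), `IsConformalBlock3D.eqOn_of_isAdmissible`
  (any two solutions agree), `eq_hrBlock_bound` (conserved currents), `eq_hrBlock_stressTensor`;
* `IsConformalBlock3D.eq_hrBlockAB_of_lt` — for ALL external dimensions, at every `Δ` strictly above the
  bound (accidental degeneracies included) every solution equals `hrBlockAB Δ₁₂ Δ₃₄ Δ ℓ` on the square;
  `isConformalBlock3D_iff_eq_hrBlockAB_of_lt`, `IsConformalBlock3D.eqOn_of_lt`;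
* assembled with `BlockSatisfiabilityIff`: on the unitary region the solution set of the typed predicate
  (functions modulo agreement on the square) is EMPTY or a SINGLETON — `isConformalBlock3D_zero_zero_iff`
  (equal dimensions: iff `(Δ,ℓ) ≠ (1/2,0)` and `g = hrBlock` on the square) and
  `isConformalBlock3D_iff_bound_lt_and_eq` (generic unequal dimensions: iff `Δ` strictly above the bound and
  `g = hrBlockAB` on the square);
* consequences for the `σ–ε` data: `SatisfiesSigmaAxioms.gp_eq_hrBlock` / `SatisfiesBootstrapAxioms.gp_eq_hrBlock`
  (every `ℤ₂`-even block function of an axiom-satisfying datum IS `hrBlock (Δp i) (ℓp i)` on the square —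
  no regularity hypothesis), `SatisfiesBootstrapAxioms.gpm_eq_hrBlockAB` / `gmm_eq_hrBlockAB` (odd sector,
  `Δ_σ ≠ Δ_ε`, `4Δ_σε² ≠ 1`);
* the evaluator's series at every admissible point: `hasSum_hrZTerm_hrBlock` (the `(n,j)` `z`-series of
  `hrBlock` above the bound, accidental points included), `hasSum_hrZTerm_hrBlock_bound` (AT the bound,
  `ℓ ≥ 1`, from the single Legendre trajectory of `FreeScalarBlockDecomposition`),
  `IsConformalBlock3D.hasSum_hrZTerm_of_isAdmissible`, `nonneg_of_isAdmissible`, the diagonal series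
  `hasSum_diag_of_isAdmissible` and the two-sided cell enclosure `diag_mem_Icc_of_isAdmissible` — the T1 chain
  typed predicate ⇒ explicit non-negative series ⇒ enclosure now holds at the bound and on the exceptional
  set too (before: strictly above the bound and off the set).

Proof of uniqueness under the limit clause (ours, elementary): if `g` is the pointwise limit of generic
blocks `G Δ'`, `Δ' ↓ Δ₀`, then for `Δ'` in a right neighbourhood of `Δ₀` the point `(Δ', ℓ)` is regular
(`eventually_isRegularPoint3D_nhdsGT_of_bound_le`: the accidental set of a spin is finite above the bound),
so `G Δ' = hrBlock Δ'` on the square by uniqueness at regular points, and `hrBlock Δ' → hrBlock Δ₀` pointwise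
(`IsAdmissible3D.tendsto_hrBlock`, Tannery); limits in `ℝ` are unique. The predicate only sees the germ of
`g` along the slices through points of the open square (`casimirEq3D_congr`), so conversely every function
agreeing with `hrBlock Δ₀ ℓ` on the square satisfies it.

References: F. Kos, D. Poland, D. Simmons-Duffin, JHEP 11 (2014) 109 [arXiv:1406.4858], §4 eqs. (4.2)–(4.3)
(blocks at special `Δ` defined by continuation; pole table) [cite: KosPolandSimmonsduffin2014, §4 eqs. (4.2)–(4.3)];
M. Hogervorst, S. Rychkov, Phys. Rev. D 87 (2013) 106004 [arXiv:1303.1111], §2.2 eq. (2.27) (the recursion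
defining the series) [cite: HogervorstRychkov2013, §2.2 eq. (2.27)]; F. A. Dolan, H. Osborn, Nucl. Phys. B 678
(2004) 491, §3 eqs. (3.10)–(3.12) [cite: DolanOsborn2004, §3 eqs. (3.10)–(3.12)]. No new hypothesis-style fact
is introduced; nothing here is specific to the Ising data.
-/

namespace Literature.MathematicalPhysics.QuantumFieldTheory.ConformalBootstrap3D

open Set Filter Topology Finset

/-! ### 1. The predicate sees only the values on the open square -/

/-- The typed Casimir equation at a point of the open square depends only on the values of `g` on the
open square (the derivatives are taken along the slices, which lie in the square near the point).
[cite: DolanOsborn2011, §2 eqs. (2.10)–(2.12)] -/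
theorem casimirEq3D_congr {Δ₁₂ Δ₃₄ Δ : ℝ} {ℓ : ℕ} {g₁ g₂ : ℝ → ℝ → ℝ}
    (h : ∀ z zb : ℝ, z ∈ Ioo (0 : ℝ) 1 → zb ∈ Ioo (0 : ℝ) 1 → g₁ z zb = g₂ z zb)
    {z zb : ℝ} (hz : z ∈ Ioo (0 : ℝ) 1) (hzb : zb ∈ Ioo (0 : ℝ) 1) :
    CasimirEq3D Δ₁₂ Δ₃₄ Δ ℓ g₁ z zb ↔ CasimirEq3D Δ₁₂ Δ₃₄ Δ ℓ g₂ z zb := by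
  have h1 : (fun t => g₁ t zb) =ᶠ[𝓝 z] (fun t => g₂ t zb) :=
    Filter.eventuallyEq_of_mem (Ioo_mem_nhds hz.1 hz.2) fun t ht => h t zb ht hzb
  have h2 : (fun t => g₁ z t) =ᶠ[𝓝 zb] (fun t => g₂ z t) :=
    Filter.eventuallyEq_of_mem (Ioo_mem_nhds hzb.1 hzb.2) fun t ht => h z t hz ht
  unfold CasimirEq3D
  rw [dolanOsbornD_congr_of_eventuallyEq h1, dolanOsbornD_congr_of_eventuallyEq h2,
    h1.deriv_eq, h2.deriv_eq, h z zb hz hzb]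

/-- The generic block predicate is invariant under changing `g` off the open square.
[cite: DolanOsborn2011, §2 eqs. (2.5)–(2.12)] -/
theorem IsConformalBlock3DAbove.congr_square {Δ₁₂ Δ₃₄ Δ : ℝ} {ℓ : ℕ} {g₁ g₂ : ℝ → ℝ → ℝ}
    (hA : IsConformalBlock3DAbove Δ₁₂ Δ₃₄ Δ ℓ g₁)
    (h : ∀ z zb : ℝ, z ∈ Ioo (0 : ℝ) 1 → zb ∈ Ioo (0 : ℝ) 1 → g₁ z zb = g₂ z zb) :
    IsConformalBlock3DAbove Δ₁₂ Δ₃₄ Δ ℓ g₂ := by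
  obtain ⟨k, K, hS, hsym, hlead, hg, hC⟩ := hA
  refine ⟨k, K, hS, hsym, hlead, fun z zb hz hzb => ?_, fun z zb hz hzb => ?_⟩
  · rw [← h z zb hz hzb]
    exact hg z zb hz hzb
  · exact (casimirEq3D_congr h hz hzb).mp (hC z zb hz hzb)

/-- The genuine block predicate (both clauses) is invariant under changing `g` off the open square.
[cite: KosPolandSimmonsduffin2014, §4 eqs. (4.2)–(4.3)] -/
theorem IsConformalBlock3D.congr_square {Δ₁₂ Δ₃₄ Δ : ℝ} {ℓ : ℕ} {g₁ g₂ : ℝ → ℝ → ℝ}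
    (hB : IsConformalBlock3D Δ₁₂ Δ₃₄ Δ ℓ g₁)
    (h : ∀ z zb : ℝ, z ∈ Ioo (0 : ℝ) 1 → zb ∈ Ioo (0 : ℝ) 1 → g₁ z zb = g₂ z zb) :
    IsConformalBlock3D Δ₁₂ Δ₃₄ Δ ℓ g₂ := by
  rcases hB with ⟨hreg, hA⟩ | ⟨hnreg, G, hG, hlim⟩
  · exact Or.inl ⟨hreg, hA.congr_square h⟩
  · refine Or.inr ⟨hnreg, G, hG, fun z zb hz hzb => ?_⟩
    rw [← h z zb hz hzb]
    exact hlim z zb hz hzb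

/-! ### 2. Equal external dimensions: uniqueness at every admissible point -/

/-- **Uniqueness of the typed block at every admissible point (equal external dimensions).** For
`(Δ₀, ℓ)` admissible — `Δ₀ ≥ ℓ + 1` if `ℓ ≥ 1`, `Δ₀ > 1/2` if `ℓ = 0`; regular or not — every function
satisfying `IsConformalBlock3D 0 0 Δ₀ ℓ` equals `hrBlock Δ₀ ℓ` on the open square. At a regular point this is
`IsConformalBlock3D.eq_hrBlock`; at the unitarity bound and on the accidental-degeneracy set it is uniqueness
under the LIMIT clause: the witnessing generic blocks `G Δ'`, `Δ' ↓ Δ₀`, are eventually at regular points, hence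
equal to `hrBlock Δ'`, which converges to `hrBlock Δ₀` pointwise.
[cite: KosPolandSimmonsduffin2014, §4 eqs. (4.2)–(4.3)] -/
theorem IsConformalBlock3D.eq_hrBlock_of_isAdmissible {Δ₀ : ℝ} {ℓ : ℕ} {g : ℝ → ℝ → ℝ}
    (hadm : IsAdmissible3D Δ₀ ℓ) (hg : IsConformalBlock3D 0 0 Δ₀ ℓ g) :
    ∀ z zb : ℝ, z ∈ Ioo (0 : ℝ) 1 → zb ∈ Ioo (0 : ℝ) 1 → g z zb = hrBlock Δ₀ ℓ z zb := by
  intro z zb hz hzb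
  rcases hg with ⟨hreg, hA⟩ | ⟨_, G, hG, hlim⟩
  · have hlt : unitarityBound3D ℓ < Δ₀ := lt_of_le_of_ne hadm.1 (Ne.symm hreg.1)
    exact hA.eq_hrBlock hlt hreg.2 z zb hz hzb
  · have hev : ∀ᶠ Δ' in 𝓝[>] Δ₀, G Δ' z zb = hrBlock Δ' ℓ z zb := by
      filter_upwards [eventually_isRegularPoint3D_nhdsGT_of_bound_le hadm.1,
        Ioo_mem_nhdsGT (show Δ₀ < Δ₀ + 1 by linarith)] with Δ' hreg' hΔ'
      have hlt : unitarityBound3D ℓ < Δ' := lt_of_le_of_lt hadm.1 hΔ'.1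
      exact (hG Δ' hΔ').eq_hrBlock hlt hreg'.2 z zb hz hzb
    have h1 : Tendsto (fun Δ' => hrBlock Δ' ℓ z zb) (𝓝[>] Δ₀) (𝓝 (g z zb)) :=
      (hlim z zb hz hzb).congr' hev
    exact tendsto_nhds_unique h1 (hadm.tendsto_hrBlock hz hzb)

/-- **The typed predicate at an admissible point, solved**: `IsConformalBlock3D 0 0 Δ₀ ℓ g` holds iff `g`
agrees with `hrBlock Δ₀ ℓ` on the open square (existence `IsAdmissible3D.isConformalBlock3D_hrBlock` +
uniqueness + invariance off the square). [cite: KosPolandSimmonsduffin2014, §4 eqs. (4.2)–(4.3)] -/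
theorem IsAdmissible3D.isConformalBlock3D_iff {Δ₀ : ℝ} {ℓ : ℕ} {g : ℝ → ℝ → ℝ}
    (hadm : IsAdmissible3D Δ₀ ℓ) :
    IsConformalBlock3D 0 0 Δ₀ ℓ g ↔
      ∀ z zb : ℝ, z ∈ Ioo (0 : ℝ) 1 → zb ∈ Ioo (0 : ℝ) 1 → g z zb = hrBlock Δ₀ ℓ z zb :=
  ⟨fun hg => hg.eq_hrBlock_of_isAdmissible hadm,
    fun h => hadm.isConformalBlock3D_hrBlock.congr_square fun z zb hz hzb => (h z zb hz hzb).symm⟩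

/-- **Any two typed blocks at an admissible point agree on the square** (regular or not).
[cite: KosPolandSimmonsduffin2014, §4 eqs. (4.2)–(4.3)] -/
theorem IsConformalBlock3D.eqOn_of_isAdmissible {Δ₀ : ℝ} {ℓ : ℕ} {g₁ g₂ : ℝ → ℝ → ℝ}
    (hadm : IsAdmissible3D Δ₀ ℓ) (h₁ : IsConformalBlock3D 0 0 Δ₀ ℓ g₁)
    (h₂ : IsConformalBlock3D 0 0 Δ₀ ℓ g₂) :
    ∀ z zb : ℝ, z ∈ Ioo (0 : ℝ) 1 → zb ∈ Ioo (0 : ℝ) 1 → g₁ z zb = g₂ z zb := fun z zb hz hzb => by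
  rw [h₁.eq_hrBlock_of_isAdmissible hadm z zb hz hzb, h₂.eq_hrBlock_of_isAdmissible hadm z zb hz hzb]

/-- **The conserved-current block is unique**: for `ℓ ≥ 1` every typed block at `Δ = ℓ + 1` (where the
predicate is the limit clause and the GENERIC clause is not uniquely solvable — admixture of
`(z z̄) g_{ℓ+2,ℓ-1}`) equals `hrBlock (ℓ+1) ℓ` on the square. [cite: KosPolandSimmonsduffin2014, §4 eqs. (4.2)–(4.3)] -/
theorem IsConformalBlock3D.eq_hrBlock_bound {ℓ : ℕ} (hℓ : 1 ≤ ℓ) {g : ℝ → ℝ → ℝ}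
    (hg : IsConformalBlock3D 0 0 ((ℓ : ℝ) + 1) ℓ g) :
    ∀ z zb : ℝ, z ∈ Ioo (0 : ℝ) 1 → zb ∈ Ioo (0 : ℝ) 1 → g z zb = hrBlock ((ℓ : ℝ) + 1) ℓ z zb :=
  hg.eq_hrBlock_of_isAdmissible (isAdmissible3D_bound hℓ)

/-- The stress-tensor point `(3, 2)` is admissible. [folklore] -/
theorem isAdmissible3D_stressTensor : IsAdmissible3D 3 2 := by
  refine ⟨?_, fun h => absurd h (by norm_num)⟩
  unfold unitarityBound3D
  norm_num

/-- **The stress-tensor block is unique**: every `g` with `IsConformalBlock3D 0 0 3 2 g` equals `hrBlock 3 2`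
on the square. [cite: KosPolandSimmonsduffin2014, §4 eqs. (4.2)–(4.3)] -/
theorem IsConformalBlock3D.eq_hrBlock_stressTensor {g : ℝ → ℝ → ℝ} (hg : IsConformalBlock3D 0 0 3 2 g) :
    ∀ z zb : ℝ, z ∈ Ioo (0 : ℝ) 1 → zb ∈ Ioo (0 : ℝ) 1 → g z zb = hrBlock 3 2 z zb :=
  hg.eq_hrBlock_of_isAdmissible isAdmissible3D_stressTensor

/-- **Solution set, equal external dimensions** (with `BlockSatisfiabilityIff`): for `Δ₀ ≥ unitarityBound3D ℓ`,
`IsConformalBlock3D 0 0 Δ₀ ℓ g` holds iff `(Δ₀, ℓ)` is not the free-scalar point `(1/2, 0)` AND `g` agrees with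
`hrBlock Δ₀ ℓ` on the square — the solution set is empty at `(1/2,0)` and the singleton `{hrBlock Δ₀ ℓ}`
(modulo values off the square) everywhere else on the unitary region. [cite: KosPolandSimmonsduffin2014, §4 eqs. (4.2)–(4.3)] -/
theorem isConformalBlock3D_zero_zero_iff {ℓ : ℕ} {Δ₀ : ℝ} (hb : unitarityBound3D ℓ ≤ Δ₀)
    {g : ℝ → ℝ → ℝ} :
    IsConformalBlock3D 0 0 Δ₀ ℓ g ↔
      ¬ (ℓ = 0 ∧ Δ₀ = 1 / 2) ∧
        ∀ z zb : ℝ, z ∈ Ioo (0 : ℝ) 1 → zb ∈ Ioo (0 : ℝ) 1 → g z zb = hrBlock Δ₀ ℓ z zb := by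
  have hadm_of : ¬ (ℓ = 0 ∧ Δ₀ = 1 / 2) → IsAdmissible3D Δ₀ ℓ := fun hne => by
    refine ⟨hb, fun hℓ => ?_⟩
    subst hℓ
    have hb0 : unitarityBound3D 0 = 1 / 2 := by simp [unitarityBound3D]
    rw [hb0] at hb ⊢
    exact lt_of_le_of_ne hb (fun heq => hne ⟨rfl, heq.symm⟩)
  constructor
  · intro hg
    have hne : ¬ (ℓ = 0 ∧ Δ₀ = 1 / 2) := (exists_isConformalBlock3D_zero_zero_iff hb).mp ⟨g, hg⟩
    exact ⟨hne, hg.eq_hrBlock_of_isAdmissible (hadm_of hne)⟩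
  · rintro ⟨hne, h⟩
    exact (hadm_of hne).isConformalBlock3D_iff.mpr h

/-! ### 3. All external dimensions, strictly above the bound (accidental points included) -/

/-- **Uniqueness of the typed block strictly above the bound, all external dimensions.** For every
`Δ₁₂, Δ₃₄` and every `Δ₀ > unitarityBound3D ℓ` — regular or an accidental degeneracy — every function with
`IsConformalBlock3D Δ₁₂ Δ₃₄ Δ₀ ℓ g` equals `hrBlockAB Δ₁₂ Δ₃₄ Δ₀ ℓ` on the open square (same argument, with
`IsConformalBlock3DAbove.eq_hrBlockAB` and `tendsto_hrBlockAB`). [cite: DolanOsborn2004, §3 eqs. (3.10)–(3.12)] -/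
theorem IsConformalBlock3D.eq_hrBlockAB_of_lt {Δ₁₂ Δ₃₄ Δ₀ : ℝ} {ℓ : ℕ} {g : ℝ → ℝ → ℝ}
    (hΔ₀ : unitarityBound3D ℓ < Δ₀) (hg : IsConformalBlock3D Δ₁₂ Δ₃₄ Δ₀ ℓ g) :
    ∀ z zb : ℝ, z ∈ Ioo (0 : ℝ) 1 → zb ∈ Ioo (0 : ℝ) 1 → g z zb = hrBlockAB Δ₁₂ Δ₃₄ Δ₀ ℓ z zb := by
  intro z zb hz hzb
  rcases hg with ⟨hreg, hA⟩ | ⟨_, G, hG, hlim⟩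
  · exact hA.eq_hrBlockAB hΔ₀ hreg.2 z zb hz hzb
  · have hev : ∀ᶠ Δ' in 𝓝[>] Δ₀, G Δ' z zb = hrBlockAB Δ₁₂ Δ₃₄ Δ' ℓ z zb := by
      filter_upwards [eventually_isRegularPoint3D_nhdsGT_of_bound_le hΔ₀.le,
        Ioo_mem_nhdsGT (show Δ₀ < Δ₀ + 1 by linarith)] with Δ' hreg' hΔ'
      exact (hG Δ' hΔ').eq_hrBlockAB (hΔ₀.trans hΔ'.1) hreg'.2 z zb hz hzb
    have h1 : Tendsto (fun Δ' => hrBlockAB Δ₁₂ Δ₃₄ Δ' ℓ z zb) (𝓝[>] Δ₀) (𝓝 (g z zb)) :=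
      (hlim z zb hz hzb).congr' hev
    exact tendsto_nhds_unique h1 (tendsto_hrBlockAB Δ₁₂ Δ₃₄ hΔ₀ hz hzb)

/-- **The typed predicate strictly above the bound, solved** (all external dimensions):
`IsConformalBlock3D Δ₁₂ Δ₃₄ Δ₀ ℓ g` iff `g = hrBlockAB Δ₁₂ Δ₃₄ Δ₀ ℓ` on the open square.
[cite: DolanOsborn2004, §3 eqs. (3.10)–(3.12)] -/
theorem isConformalBlock3D_iff_eq_hrBlockAB_of_lt {Δ₁₂ Δ₃₄ Δ₀ : ℝ} {ℓ : ℕ} {g : ℝ → ℝ → ℝ}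
    (hΔ₀ : unitarityBound3D ℓ < Δ₀) :
    IsConformalBlock3D Δ₁₂ Δ₃₄ Δ₀ ℓ g ↔
      ∀ z zb : ℝ, z ∈ Ioo (0 : ℝ) 1 → zb ∈ Ioo (0 : ℝ) 1 → g z zb = hrBlockAB Δ₁₂ Δ₃₄ Δ₀ ℓ z zb :=
  ⟨fun hg => hg.eq_hrBlockAB_of_lt hΔ₀,
    fun h => (isConformalBlock3D_hrBlockAB_of_lt Δ₁₂ Δ₃₄ hΔ₀).congr_square
      fun z zb hz hzb => (h z zb hz hzb).symm⟩

/-- Any two typed blocks with the same parameters strictly above the bound agree on the square.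
[cite: DolanOsborn2004, §3 eqs. (3.10)–(3.12)] -/
theorem IsConformalBlock3D.eqOn_of_lt {Δ₁₂ Δ₃₄ Δ₀ : ℝ} {ℓ : ℕ} {g₁ g₂ : ℝ → ℝ → ℝ}
    (hΔ₀ : unitarityBound3D ℓ < Δ₀) (h₁ : IsConformalBlock3D Δ₁₂ Δ₃₄ Δ₀ ℓ g₁)
    (h₂ : IsConformalBlock3D Δ₁₂ Δ₃₄ Δ₀ ℓ g₂) :
    ∀ z zb : ℝ, z ∈ Ioo (0 : ℝ) 1 → zb ∈ Ioo (0 : ℝ) 1 → g₁ z zb = g₂ z zb := fun z zb hz hzb => by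
  rw [h₁.eq_hrBlockAB_of_lt hΔ₀ z zb hz hzb, h₂.eq_hrBlockAB_of_lt hΔ₀ z zb hz hzb]

/-- **Solution set, generic unequal external dimensions** (`Δ₁₂ Δ₃₄ ≠ 0`, `|Δ₁₂|, |Δ₃₄| ≠ 1/2`; with
`BlockSatisfiabilityIff`): for `Δ₀ ≥ unitarityBound3D ℓ`, `IsConformalBlock3D Δ₁₂ Δ₃₄ Δ₀ ℓ g` holds iff `Δ₀` is
STRICTLY above the bound and `g = hrBlockAB Δ₁₂ Δ₃₄ Δ₀ ℓ` on the square (empty at the poles `Δ₀ = ℓ+1`,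
`(1/2, 0)`; a singleton above). [cite: KosPolandSimmonsduffin2014, §4 eqs. (4.2)–(4.3)] -/
theorem isConformalBlock3D_iff_bound_lt_and_eq {Δ₁₂ Δ₃₄ : ℝ} (h12 : Δ₁₂ * Δ₃₄ ≠ 0)
    (hhalf : (4 * Δ₁₂ ^ 2 - 1) * (4 * Δ₃₄ ^ 2 - 1) ≠ 0) {ℓ : ℕ} {Δ₀ : ℝ}
    (hb : unitarityBound3D ℓ ≤ Δ₀) {g : ℝ → ℝ → ℝ} :
    IsConformalBlock3D Δ₁₂ Δ₃₄ Δ₀ ℓ g ↔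
      unitarityBound3D ℓ < Δ₀ ∧
        ∀ z zb : ℝ, z ∈ Ioo (0 : ℝ) 1 → zb ∈ Ioo (0 : ℝ) 1 →
          g z zb = hrBlockAB Δ₁₂ Δ₃₄ Δ₀ ℓ z zb := by
  constructor
  · intro hg
    have hlt : unitarityBound3D ℓ < Δ₀ := (exists_isConformalBlock3D_iff_bound_lt h12 hhalf hb).mp ⟨g, hg⟩
    exact ⟨hlt, hg.eq_hrBlockAB_of_lt hlt⟩
  · rintro ⟨hlt, h⟩
    exact (isConformalBlock3D_iff_eq_hrBlockAB_of_lt hlt).mpr h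

/-! ### 4. Consequences for the `σ–ε` data: every block function of a datum is the explicit series -/

namespace SigmaEpsilonData

/-- Every `ℤ₂`-even exchanged operator of a datum satisfying the single-correlator axioms sits at an
admissible point: unitarity bound (A1) and, for scalars, `Δ > 1/2` because NO function satisfies the typed
predicate at `(1/2, 0)` (`not_isConformalBlock3D_freeScalar_zero_zero`). [cite: KosPolandSimmonsduffin2014, §4 Table 1] -/
theorem SatisfiesSigmaAxioms.isAdmissible3D_p {D : SigmaEpsilonData} (hD : D.SatisfiesSigmaAxioms)
    (i : D.ιp) : IsAdmissible3D (D.Δp i) (D.ℓp i) := by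
  have hu : unitarityBound3D (D.ℓp i) ≤ D.Δp i := hD.2.1.2.2.1 i
  refine ⟨hu, fun hℓ => lt_of_le_of_ne hu (Ne.symm fun heq => ?_)⟩
  have hg := hD.1 i
  have hb0 : unitarityBound3D 0 = 1 / 2 := by simp [unitarityBound3D]
  rw [heq, hℓ, hb0] at hg
  exact not_isConformalBlock3D_freeScalar_zero_zero _ hg

/-- **Every `ℤ₂`-even block function of a datum satisfying the single-correlator axioms IS `hrBlock`** on the
open square: `gp i = hrBlock (Δp i) (ℓp i)` there, for EVERY `i` (regular points, conserved currents incl. the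
stress tensor, accidental degeneracies alike). [cite: KosPolandSimmonsduffin2014, §4 eqs. (4.2)–(4.3)] -/
theorem SatisfiesSigmaAxioms.gp_eq_hrBlock {D : SigmaEpsilonData} (hD : D.SatisfiesSigmaAxioms) (i : D.ιp) :
    ∀ z zb : ℝ, z ∈ Ioo (0 : ℝ) 1 → zb ∈ Ioo (0 : ℝ) 1 →
      D.gp i z zb = hrBlock (D.Δp i) (D.ℓp i) z zb :=
  (hD.1 i).eq_hrBlock_of_isAdmissible (hD.isAdmissible3D_p i)

/-- The same over the full typed axioms A1–A4. [cite: KosPolandSimmonsduffin2014, §4 eqs. (4.2)–(4.3)] -/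
theorem SatisfiesBootstrapAxioms.gp_eq_hrBlock {D : SigmaEpsilonData} (hD : D.SatisfiesBootstrapAxioms)
    (i : D.ιp) :
    ∀ z zb : ℝ, z ∈ Ioo (0 : ℝ) 1 → zb ∈ Ioo (0 : ℝ) 1 →
      D.gp i z zb = hrBlock (D.Δp i) (D.ℓp i) z zb :=
  hD.sigmaAxioms.gp_eq_hrBlock i

/-- Under the typed axioms with `Δ_σ ≠ Δ_ε` and `4Δ_σε² ≠ 1`, every `ℤ₂`-odd exchanged operator lies STRICTLY
above the unitarity bound (`bound_lt_Δm_of_satisfiesBootstrapAxioms` for `ℓ ≥ 1`,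
`half_lt_Δm_of_satisfiesBootstrapAxioms` for `ℓ = 0`). [cite: KosPolandSimmonsduffin2014, §4 Table 1] -/
theorem SatisfiesBootstrapAxioms.bound_lt_Δm {D : SigmaEpsilonData} (hD : D.SatisfiesBootstrapAxioms)
    (hne : D.Δσ ≠ D.Δε) (hs : 4 * D.Δσε ^ 2 ≠ 1) (j : D.ιm) :
    unitarityBound3D (D.ℓm j) < D.Δm j := by
  rcases Nat.eq_zero_or_pos (D.ℓm j) with hℓ | hℓ
  · rw [hℓ]
    have hb0 : unitarityBound3D 0 = 1 / 2 := by simp [unitarityBound3D]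
    rw [hb0]
    exact half_lt_Δm_of_satisfiesBootstrapAxioms D hD hs j hℓ
  · have hb : unitarityBound3D (D.ℓm j) = (D.ℓm j : ℝ) + 1 := by
      unfold unitarityBound3D; rw [if_neg (by omega)]
    rw [hb]
    exact bound_lt_Δm_of_satisfiesBootstrapAxioms D hD hne j hℓ

/-- **Every `⟨εσσε⟩` block function of an axiom-satisfying datum IS `hrBlockAB`** on the square
(`Δ_σ ≠ Δ_ε`, `4Δ_σε² ≠ 1`): `gpm j = hrBlockAB (-Δ_σε) Δ_σε (Δm j) (ℓm j)`.
[cite: DolanOsborn2004, §3 eqs. (3.10)–(3.12)] -/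
theorem SatisfiesBootstrapAxioms.gpm_eq_hrBlockAB {D : SigmaEpsilonData} (hD : D.SatisfiesBootstrapAxioms)
    (hne : D.Δσ ≠ D.Δε) (hs : 4 * D.Δσε ^ 2 ≠ 1) (j : D.ιm) :
    ∀ z zb : ℝ, z ∈ Ioo (0 : ℝ) 1 → zb ∈ Ioo (0 : ℝ) 1 →
      D.gpm j z zb = hrBlockAB (-D.Δσε) D.Δσε (D.Δm j) (D.ℓm j) z zb :=
  (hD.1.2.2 j).eq_hrBlockAB_of_lt (hD.bound_lt_Δm hne hs j)

/-- **Every `⟨σεσε⟩` block function of an axiom-satisfying datum IS `hrBlockAB`** on the square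
(`Δ_σ ≠ Δ_ε`, `4Δ_σε² ≠ 1`): `gmm j = hrBlockAB Δ_σε Δ_σε (Δm j) (ℓm j)`.
[cite: DolanOsborn2004, §3 eqs. (3.10)–(3.12)] -/
theorem SatisfiesBootstrapAxioms.gmm_eq_hrBlockAB {D : SigmaEpsilonData} (hD : D.SatisfiesBootstrapAxioms)
    (hne : D.Δσ ≠ D.Δε) (hs : 4 * D.Δσε ^ 2 ≠ 1) (j : D.ιm) :
    ∀ z zb : ℝ, z ∈ Ioo (0 : ℝ) 1 → zb ∈ Ioo (0 : ℝ) 1 →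
      D.gmm j z zb = hrBlockAB D.Δσε D.Δσε (D.Δm j) (D.ℓm j) z zb :=
  (hD.1.2.1 j).eq_hrBlockAB_of_lt (hD.bound_lt_Δm hne hs j)

end SigmaEpsilonData

/-! ### 5. The evaluator's series at every admissible point -/

/-- From finite row sums to the `(n, j)` `z`-series: generic in `Δ` once the degree-indexed terms are
non-negative (regrouping over `ℕ × ℕ` and the shift `N = n + ℓ`; the steps of `IsConformalBlock3D.hasSum_hrZTerm`).
[cite: HogervorstRychkov2013, §3 eqs. (3.4)–(3.6)] -/
theorem hasSum_hrZTerm_of_rows {Δ : ℝ} {ℓ : ℕ} {x y S : ℝ} (hx : 0 < x) (hy : 0 < y)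
    (hnn : ∀ q, 0 ≤ hrZTermDeg Δ ℓ x y q)
    (h1 : HasSum (fun N : ℕ => ∑ j ∈ range (N + 1), hrZTermDeg Δ ℓ x y (N, j)) S) :
    HasSum (hrZTerm Δ ℓ x y) S := by
  have h2 : HasSum (hrZTermDeg Δ ℓ x y) S :=
    hasSum_prod_of_hasSum_rows hnn (fun N j hNj => hrZTermDeg_eq_zero_of_lt Δ ℓ x y hNj) h1
  have hinj : Function.Injective (fun q : ℕ × ℕ => (q.1 + ℓ, q.2)) := by
    intro a b hab
    simp only [Prod.mk.injEq, add_left_inj] at hab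
    exact Prod.ext hab.1 hab.2
  have hoff : ∀ q : ℕ × ℕ, q ∉ Set.range (fun q : ℕ × ℕ => (q.1 + ℓ, q.2)) →
      hrZTermDeg Δ ℓ x y q = 0 := by
    intro q hq
    have hlt : q.1 < ℓ := by
      by_contra hge
      rw [not_lt] at hge
      exact hq ⟨(q.1 - ℓ, q.2), Prod.ext (Nat.sub_add_cancel hge) rfl⟩
    unfold hrZTermDeg
    rw [if_neg (by omega)]
  have h3 := (hinj.hasSum_iff hoff).mpr h2
  have hfun' : (hrZTermDeg Δ ℓ x y ∘ fun q : ℕ × ℕ => (q.1 + ℓ, q.2)) = hrZTerm Δ ℓ x y :=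
    funext fun q => hrZTermDeg_shift hx hy q.1 q.2
  rw [hfun'] at h3
  exact h3

/-- **The `z`-series of `hrBlock` at a real point of the square, for EVERY `Δ` strictly above the bound**
(accidental degeneracies included — no uniqueness is needed for the explicit series):
`hrBlock Δ ℓ x y = Σ_{(n,j)} (A_{n,j}/λ_ℓ) 𝒫_{Δ+n,j}(x,y)`. [cite: HogervorstRychkov2013, §3 eqs. (3.4), (3.9)] -/
theorem hasSum_hrZTerm_hrBlock {Δ : ℝ} {ℓ : ℕ} (hΔ : unitarityBound3D ℓ < Δ) {x y : ℝ}
    (hx : x ∈ Ioo (0 : ℝ) 1) (hy : y ∈ Ioo (0 : ℝ) 1) :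
    HasSum (hrZTerm Δ ℓ x y) (hrBlock Δ ℓ x y) := by
  have h1 := ((isDoublePowerSeriesOn_hrSeries hΔ).hasSum_antidiagonal hx.1.le hx.2 hy.1.le hy.2).mul_left
    ((x * y) ^ ((Δ - (ℓ : ℝ)) / 2))
  have hfun : (fun N : ℕ => (x * y) ^ ((Δ - (ℓ : ℝ)) / 2) *
      ∑ p ∈ antidiagonal N, hrMonomialCoeff Δ ℓ p * x ^ p.1 * y ^ p.2) =
      fun N : ℕ => ∑ j ∈ range (N + 1), hrZTermDeg Δ ℓ x y (N, j) :=
    funext fun N => (sum_range_hrZTermDeg Δ ℓ x y N).symm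
  rw [hfun] at h1
  unfold hrBlock
  exact hasSum_hrZTerm_of_rows hx.1 hy.1 (hrZTermDeg_nonneg hΔ hx.1.le hy.1.le) h1

/-- At the unitarity bound `Δ = ℓ + 1` every coefficient `A_{n,j}(ℓ+1, ℓ)` is non-negative (single Legendre
trajectory `A_{n,ℓ+n} = C(2ℓ+2n,n)/4^n`, zero elsewhere). [cite: DolanOsborn2011, §6 eq. (6.20)] -/
theorem hrCoeff_bound_nonneg (ℓ n j : ℕ) : 0 ≤ hrCoeff ((ℓ : ℝ) + 1) ℓ n j := by
  by_cases hj : j = ℓ + n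
  · rw [hj, hrCoeff_bound_leading]
    positivity
  · rw [hrCoeff_bound_eq_zero_of_ne ℓ hj]

/-- Non-negativity of every coefficient `A_{n,j}(Δ₀, ℓ)` at an admissible point. [cite: HogervorstRychkov2013, §3 after eq. (3.9)] -/
theorem IsAdmissible3D.hrCoeff_nonneg {Δ₀ : ℝ} {ℓ : ℕ} (hadm : IsAdmissible3D Δ₀ ℓ) (n j : ℕ) :
    0 ≤ hrCoeff Δ₀ ℓ n j := by
  rcases (hadm.1).lt_or_eq with hlt | heq
  · exact ConformalBootstrap3D.hrCoeff_nonneg hlt n j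
  · have hℓ : 1 ≤ ℓ := by
      by_contra h0
      have h0' : ℓ = 0 := by omega
      exact absurd heq (hadm.2 h0').ne
    have hΔ : Δ₀ = (ℓ : ℝ) + 1 := by
      rw [← heq]; unfold unitarityBound3D; rw [if_neg (by omega)]
    rw [hΔ]
    exact hrCoeff_bound_nonneg ℓ n j

/-- The level sums are non-negative at an admissible point. [cite: HogervorstRychkov2013, §3 after eq. (3.9)] -/
theorem IsAdmissible3D.hrLevelSum_nonneg {Δ₀ : ℝ} {ℓ : ℕ} (hadm : IsAdmissible3D Δ₀ ℓ) (n : ℕ) :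
    0 ≤ hrLevelSum Δ₀ ℓ n :=
  Finset.sum_nonneg fun j _ => hadm.hrCoeff_nonneg n j

/-- The diagonal coefficients are non-negative at an admissible point. [cite: HogervorstRychkov2013, §3 eq. (3.9)] -/
theorem IsAdmissible3D.hrDiagCoeff_nonneg {Δ₀ : ℝ} {ℓ : ℕ} (hadm : IsAdmissible3D Δ₀ ℓ) (n : ℕ) :
    0 ≤ hrDiagCoeff Δ₀ ℓ n :=
  div_nonneg (hadm.hrLevelSum_nonneg n) (legendreLam_pos ℓ).le

/-- The degree-indexed terms are non-negative at an admissible point. [folklore] -/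
theorem IsAdmissible3D.hrZTermDeg_nonneg {Δ₀ : ℝ} {ℓ : ℕ} (hadm : IsAdmissible3D Δ₀ ℓ) {x y : ℝ}
    (hx : 0 ≤ x) (hy : 0 ≤ y) (q : ℕ × ℕ) : 0 ≤ hrZTermDeg Δ₀ ℓ x y q := by
  unfold hrZTermDeg
  split_ifs
  · refine mul_nonneg (Real.rpow_nonneg (mul_nonneg hx hy) _) (mul_nonneg ?_ ?_)
    · exact div_nonneg (hadm.hrCoeff_nonneg _ _) (legendreLam_pos ℓ).le
    · exact mul_nonneg (pow_nonneg (mul_nonneg hx hy) _) (zLegendre_nonneg _ hx hy)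
  · exact le_rfl

/-- The `z`-series terms are non-negative at an admissible point. [cite: HogervorstRychkov2013, §3 after eq. (3.9)] -/
theorem IsAdmissible3D.hrZTerm_nonneg {Δ₀ : ℝ} {ℓ : ℕ} (hadm : IsAdmissible3D Δ₀ ℓ) {x y : ℝ}
    (hx : 0 ≤ x) (hy : 0 ≤ y) (q : ℕ × ℕ) : 0 ≤ hrZTerm Δ₀ ℓ x y q :=
  mul_nonneg (div_nonneg (hadm.hrCoeff_nonneg _ _) (legendreLam_pos ℓ).le) (zMono_nonneg _ _ hx hy)

/-- **The `z`-series of the conserved-current block** `hrBlock (ℓ+1) ℓ` at a real point of the square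
(`ℓ ≥ 1` or `ℓ = 0` alike as a statement about the series; bounded coefficients,
`FreeScalarBlockDecomposition.hasSum_hrSeries_bound`). [cite: DolanOsborn2011, §6 eq. (6.20)] -/
theorem hasSum_hrZTerm_hrBlock_bound (ℓ : ℕ) {x y : ℝ} (hx : x ∈ Ioo (0 : ℝ) 1) (hy : y ∈ Ioo (0 : ℝ) 1) :
    HasSum (hrZTerm ((ℓ : ℝ) + 1) ℓ x y) (hrBlock ((ℓ : ℝ) + 1) ℓ x y) := by
  have hS := hasSum_hrSeries_bound ℓ hx hy
  have h0 := hasSum_sum_antidiagonal_of_summable hS.summable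
  rw [hS.tsum_eq] at h0
  have h1 := h0.mul_left ((x * y) ^ ((((ℓ : ℝ) + 1) - (ℓ : ℝ)) / 2))
  have hfun : (fun N : ℕ => (x * y) ^ ((((ℓ : ℝ) + 1) - (ℓ : ℝ)) / 2) *
      ∑ p ∈ antidiagonal N, hrMonomialCoeff ((ℓ : ℝ) + 1) ℓ p * x ^ p.1 * y ^ p.2) =
      fun N : ℕ => ∑ j ∈ range (N + 1), hrZTermDeg ((ℓ : ℝ) + 1) ℓ x y (N, j) :=
    funext fun N => (sum_range_hrZTermDeg ((ℓ : ℝ) + 1) ℓ x y N).symm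
  rw [hfun] at h1
  unfold hrBlock
  by_cases hℓ : 1 ≤ ℓ
  · exact hasSum_hrZTerm_of_rows hx.1 hy.1
      ((isAdmissible3D_bound hℓ).hrZTermDeg_nonneg hx.1.le hy.1.le) h1
  · -- `ℓ = 0`: the point `(1, 0)` is strictly above the bound `1/2`
    have hℓ0 : ℓ = 0 := by omega
    subst hℓ0
    have hlt : unitarityBound3D 0 < ((0 : ℕ) : ℝ) + 1 := by
      simp [unitarityBound3D]; norm_num
    exact hasSum_hrZTerm_of_rows hx.1 hy.1 (hrZTermDeg_nonneg hlt hx.1.le hy.1.le) h1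

/-- **The `z`-series of `hrBlock` at EVERY admissible point.** [cite: HogervorstRychkov2013, §3 eqs. (3.4), (3.9)] -/
theorem IsAdmissible3D.hasSum_hrZTerm_hrBlock {Δ₀ : ℝ} {ℓ : ℕ} (hadm : IsAdmissible3D Δ₀ ℓ) {x y : ℝ}
    (hx : x ∈ Ioo (0 : ℝ) 1) (hy : y ∈ Ioo (0 : ℝ) 1) :
    HasSum (hrZTerm Δ₀ ℓ x y) (hrBlock Δ₀ ℓ x y) := by
  rcases (hadm.1).lt_or_eq with hlt | heq
  · exact ConformalBootstrap3D.hasSum_hrZTerm_hrBlock hlt hx hy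
  · have hℓ : 1 ≤ ℓ := by
      by_contra h0
      have h0' : ℓ = 0 := by omega
      exact absurd heq (hadm.2 h0').ne
    have hΔ : Δ₀ = (ℓ : ℝ) + 1 := by
      rw [← heq]; unfold unitarityBound3D; rw [if_neg (by omega)]
    rw [hΔ]
    exact hasSum_hrZTerm_hrBlock_bound ℓ hx hy

/-- **T1 off the diagonal at every admissible point.** Every function with `IsConformalBlock3D 0 0 Δ₀ ℓ g`
at an admissible `(Δ₀, ℓ)` — regular, at the unitarity bound, or on the accidental-degeneracy set — satisfies
`g(x,y) = Σ_{(n,j)} (A_{n,j}(Δ₀,ℓ)/λ_ℓ) 𝒫_{Δ₀+n,j}(x,y)` at every real point of the square, a convergent double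
series of non-negative terms (generalises `IsConformalBlock3D.hasSum_hrZTerm`, which needs a regular point).
[cite: HogervorstRychkov2013, §3 eqs. (3.4), (3.9)] -/
theorem IsConformalBlock3D.hasSum_hrZTerm_of_isAdmissible {Δ₀ : ℝ} {ℓ : ℕ} {g : ℝ → ℝ → ℝ}
    (hadm : IsAdmissible3D Δ₀ ℓ) (hg : IsConformalBlock3D 0 0 Δ₀ ℓ g) {x y : ℝ}
    (hx : x ∈ Ioo (0 : ℝ) 1) (hy : y ∈ Ioo (0 : ℝ) 1) :
    HasSum (hrZTerm Δ₀ ℓ x y) (g x y) := by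
  rw [hg.eq_hrBlock_of_isAdmissible hadm x y hx hy]
  exact hadm.hasSum_hrZTerm_hrBlock hx hy

/-- Every finite partial sum of the `z`-series is a lower bound, at every admissible point.
[cite: HogervorstRychkov2013, §3 eq. (3.9)] -/
theorem IsConformalBlock3D.sum_hrZTerm_le_of_isAdmissible {Δ₀ : ℝ} {ℓ : ℕ} {g : ℝ → ℝ → ℝ}
    (hadm : IsAdmissible3D Δ₀ ℓ) (hg : IsConformalBlock3D 0 0 Δ₀ ℓ g) {x y : ℝ}
    (hx : x ∈ Ioo (0 : ℝ) 1) (hy : y ∈ Ioo (0 : ℝ) 1) (F : Finset (ℕ × ℕ)) :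
    ∑ q ∈ F, hrZTerm Δ₀ ℓ x y q ≤ g x y :=
  sum_le_hasSum F (fun q _ => hadm.hrZTerm_nonneg hx.1.le hy.1.le q)
    (hg.hasSum_hrZTerm_of_isAdmissible hadm hx hy)

/-- **A typed block is non-negative at every real point of the square, at every admissible point**
(regular or not). [cite: HogervorstRychkov2013, §3 after eq. (3.9)] -/
theorem IsConformalBlock3D.nonneg_of_isAdmissible {Δ₀ : ℝ} {ℓ : ℕ} {g : ℝ → ℝ → ℝ}
    (hadm : IsAdmissible3D Δ₀ ℓ) (hg : IsConformalBlock3D 0 0 Δ₀ ℓ g) {x y : ℝ}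
    (hx : x ∈ Ioo (0 : ℝ) 1) (hy : y ∈ Ioo (0 : ℝ) 1) : 0 ≤ g x y := by
  simpa using hg.sum_hrZTerm_le_of_isAdmissible hadm hx hy ∅

/-- **The diagonal series of `hrBlock` at every admissible point**: `hrBlock Δ₀ ℓ y y = Σ_n a_n y^{Δ₀+n}`,
`a_n = hrDiagCoeff Δ₀ ℓ n = (Σ_j A_{n,j})/λ_ℓ` (fibrewise summation of the `z`-series on the diagonal,
`𝒫_{E,j}(y,y) = y^E`). [cite: HogervorstRychkov2013, §3 eqs. (3.4), (3.9)] -/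
theorem IsAdmissible3D.hasSum_diag_hrBlock {Δ₀ : ℝ} {ℓ : ℕ} (hadm : IsAdmissible3D Δ₀ ℓ) {y : ℝ}
    (hy : y ∈ Ioo (0 : ℝ) 1) :
    HasSum (fun n : ℕ => hrDiagCoeff Δ₀ ℓ n * y ^ (Δ₀ + n)) (hrBlock Δ₀ ℓ y y) := by
  have h := hadm.hasSum_hrZTerm_hrBlock hy hy
  refine h.prod_fiberwise fun n => ?_
  have hrow : HasSum (fun j : ℕ => hrZTerm Δ₀ ℓ y y (n, j))
      (∑ j ∈ range (ℓ + n + 1), hrZTerm Δ₀ ℓ y y (n, j)) :=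
    hasSum_sum_of_ne_finset_zero fun j hj => by
      rw [Finset.mem_range, not_lt] at hj
      unfold hrZTerm
      rw [hrCoeff_eq_zero_of_lt Δ₀ (show ℓ + n < j by omega), zero_div, zero_mul]
  have hval : ∑ j ∈ range (ℓ + n + 1), hrZTerm Δ₀ ℓ y y (n, j) =
      hrDiagCoeff Δ₀ ℓ n * y ^ (Δ₀ + n) := by
    unfold hrDiagCoeff hrLevelSum hrZTerm
    rw [Finset.sum_div, Finset.sum_mul]
    refine Finset.sum_congr rfl fun j _ => ?_
    rw [zMono_diag _ _ hy.1]
  rw [← hval]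
  exact hrow

/-- **T1 on the diagonal at every admissible point**: the diagonal of any typed block is the explicit
non-negative series `g(y,y) = Σ_n a_n(Δ₀,ℓ) y^{Δ₀+n}` (generalises `IsConformalBlock3D.hasSum_diag`).
[cite: HogervorstRychkov2013, §3 eqs. (3.4), (3.9)] -/
theorem IsConformalBlock3D.hasSum_diag_of_isAdmissible {Δ₀ : ℝ} {ℓ : ℕ} {g : ℝ → ℝ → ℝ}
    (hadm : IsAdmissible3D Δ₀ ℓ) (hg : IsConformalBlock3D 0 0 Δ₀ ℓ g) {y : ℝ} (hy : y ∈ Ioo (0 : ℝ) 1) :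
    HasSum (fun n : ℕ => hrDiagCoeff Δ₀ ℓ n * y ^ (Δ₀ + n)) (g y y) := by
  rw [hg.eq_hrBlock_of_isAdmissible hadm y y hy hy]
  exact hadm.hasSum_diag_hrBlock hy

/-- The diagonal value as a `tsum`, at every admissible point. [cite: HogervorstRychkov2013, §3 eqs. (3.4), (3.9)] -/
theorem IsConformalBlock3D.diag_eq_tsum_of_isAdmissible {Δ₀ : ℝ} {ℓ : ℕ} {g : ℝ → ℝ → ℝ}
    (hadm : IsAdmissible3D Δ₀ ℓ) (hg : IsConformalBlock3D 0 0 Δ₀ ℓ g) {y : ℝ} (hy : y ∈ Ioo (0 : ℝ) 1) :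
    g y y = ∑' n : ℕ, hrDiagCoeff Δ₀ ℓ n * y ^ (Δ₀ + n) :=
  (hg.hasSum_diag_of_isAdmissible hadm hy).tsum_eq.symm

/-- Every truncation of the diagonal series is a lower bound, at every admissible point.
[cite: HogervorstRychkov2013, §3 eq. (3.9)] -/
theorem IsConformalBlock3D.partialSum_le_diag_of_isAdmissible {Δ₀ : ℝ} {ℓ : ℕ} {g : ℝ → ℝ → ℝ}
    (hadm : IsAdmissible3D Δ₀ ℓ) (hg : IsConformalBlock3D 0 0 Δ₀ ℓ g) {y : ℝ} (hy : y ∈ Ioo (0 : ℝ) 1)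
    (N : ℕ) : hrDiagPartialSum Δ₀ ℓ N y ≤ g y y :=
  sum_le_hasSum (range (N + 1)) (fun n _ => mul_nonneg (hadm.hrDiagCoeff_nonneg n)
    (Real.rpow_nonneg hy.1.le _)) (hg.hasSum_diag_of_isAdmissible hadm hy)

/-- **Ratio domination along the diagonal at every admissible point**: for `0 < y ≤ y' < 1`,
`g(y,y) ≤ (y/y')^{Δ₀} g(y',y')`. [cite: HogervorstRychkov2013, §3 eq. (3.9)] -/
theorem IsConformalBlock3D.diag_ratio_le_of_isAdmissible {Δ₀ : ℝ} {ℓ : ℕ} {g : ℝ → ℝ → ℝ}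
    (hadm : IsAdmissible3D Δ₀ ℓ) (hg : IsConformalBlock3D 0 0 Δ₀ ℓ g) {y y' : ℝ} (hy : 0 < y)
    (hyy' : y ≤ y') (hy'1 : y' < 1) :
    g y y ≤ (y / y') ^ Δ₀ * g y' y' := by
  have hyI : y ∈ Ioo (0 : ℝ) 1 := ⟨hy, lt_of_le_of_lt hyy' hy'1⟩
  have hy'I : y' ∈ Ioo (0 : ℝ) 1 := ⟨lt_of_lt_of_le hy hyy', hy'1⟩
  rw [hg.diag_eq_tsum_of_isAdmissible hadm hyI, hg.diag_eq_tsum_of_isAdmissible hadm hy'I]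
  exact tsum_rpow_ratio_le hadm.hrDiagCoeff_nonneg hy hyy'
    (hg.hasSum_diag_of_isAdmissible hadm hy'I).summable

/-- **End-to-end cell enclosure of a typed block on the diagonal, at EVERY admissible point** (the bound
`Δ₀ = ℓ+1` and the accidental-degeneracy set included; generalises `IsConformalBlock3D.diag_mem_Icc`): for
`0 < y ≤ y' < 1`, a truncation order `N` and an upper bound `U ≥ g(y',y')`,
`g(y,y) ∈ [S_N(y), S_N(y) + (y/y')^{Δ₀+N+1} (U − S_N(y'))]`. [cite: HogervorstRychkov2013, §3 eqs. (3.4), (3.9)] -/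
theorem IsConformalBlock3D.diag_mem_Icc_of_isAdmissible {Δ₀ : ℝ} {ℓ : ℕ} {g : ℝ → ℝ → ℝ}
    (hadm : IsAdmissible3D Δ₀ ℓ) (hg : IsConformalBlock3D 0 0 Δ₀ ℓ g) {y y' U : ℝ} (hy : 0 < y)
    (hyy' : y ≤ y') (hy'1 : y' < 1) (N : ℕ) (hU : g y' y' ≤ U) :
    g y y ∈ Icc (hrDiagPartialSum Δ₀ ℓ N y)
      (hrDiagPartialSum Δ₀ ℓ N y + (y / y') ^ (Δ₀ + N + 1) * (U - hrDiagPartialSum Δ₀ ℓ N y')) := by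
  have hyI : y ∈ Ioo (0 : ℝ) 1 := ⟨hy, lt_of_le_of_lt hyy' hy'1⟩
  have hy'I : y' ∈ Ioo (0 : ℝ) 1 := ⟨lt_of_lt_of_le hy hyy', hy'1⟩
  have hU' : ∑' n : ℕ, hrDiagCoeff Δ₀ ℓ n * y' ^ (Δ₀ + n) ≤ U := by
    rw [← hg.diag_eq_tsum_of_isAdmissible hadm hy'I]; exact hU
  rw [hg.diag_eq_tsum_of_isAdmissible hadm hyI]
  exact tsum_rpow_mem_Icc hadm.hrDiagCoeff_nonneg hy hyy'
    (hg.hasSum_diag_of_isAdmissible hadm hy'I).summable N hU'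

/-- **The stress-tensor block, evaluated**: every `g` with `IsConformalBlock3D 0 0 3 2 g` has the diagonal
series `g(y,y) = Σ_n a_n(3,2) y^{3+n}` and the cell enclosure above — the operator present in every local CFT,
sitting exactly where the generic predicate is degenerate. [cite: KosPolandSimmonsduffin2014, §4 eqs. (4.2)–(4.3)] -/
theorem IsConformalBlock3D.hasSum_diag_stressTensor {g : ℝ → ℝ → ℝ} (hg : IsConformalBlock3D 0 0 3 2 g)
    {y : ℝ} (hy : y ∈ Ioo (0 : ℝ) 1) :
    HasSum (fun n : ℕ => hrDiagCoeff 3 2 n * y ^ ((3 : ℝ) + n)) (g y y) := by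
  exact hg.hasSum_diag_of_isAdmissible isAdmissible3D_stressTensor hy

end Literature.MathematicalPhysics.QuantumFieldTheory.ConformalBootstrap3D
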